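import Literature.Computability.Complexity.OccurrenceObstructionsIPProofs
import Literature.Computability.AlgebraicComplexity.OrbitCoordinateRingProofs
import Literature.Computability.AlgebraicComplexity.MultiplicityObstructionsProofs
import Literature.Computability.AlgebraicComplexity.PlethysmLifting
import HarnessLib

/-!
# Eventual inheritance of per-side multiplicities under padding
# (crux `ValuativeGCT.ValuativeFlip`, stmt-ValiantsHypothesis-12624; size-transfer axis S1)

Wall-breaker k4 (gen 1; axis "representation-stability transfer between `m` and `m + 1`"), helper file
`--supports stmt-ValiantsHypothesis-12624`.  The per-side transfer along the padding `n ↦ n + j` that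
IS provable for orbit closures (BLMW 2011 Problem 6.10 asks for `P_n(μ) ≤ mult_{(μ♯)*}` at EVERY
padding; open) is the Δ_j-TWISTED transport of evaluation certificates (`stub_twistedInheritance`,
`ValuativeGCTValuativeFlipTwistedInheritance`, wall-breaker k12).  This file turns it into a
statement about multiplicities themselves, for all but finitely many paddings:

* Part A `exists_evalCertificate_of_le_orbitMultiplicity` (registered stub; converse of the engine
  `stub_evalRankLowerBound`): `D ≤ mult_χ ℂ[Δ_m(f)]` gives highest-weight vectors `F₁…F_D` and
  invertible points `A₁…A_D` with `det (F_i(A_l · f)) ≠ 0` — evaluation certificates are COMPLETE, so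
  `P_n(μ) = mult_{μ*} ℂ[Δ_n(per_n)]` is an evaluation rank (lifting of highest-weight vectors by complete
  reducibility, `map_highestWeightSpace_eq_of_surjective`; the evaluation vectors at `GL`-points span
  `ℂ^D`).
* Part B `twisted_aeval_eq_pow_mul_eval`: the twist `(e_top + j).descFactorial j = j! · P_{e_top}(j)`,
  `P_e = (X+1)⋯(X+e)/e!` (inline), so on a form of degree `δ` the twisted evaluation is
  `(j!)^δ · Q(j)` with `Q ∈ ℂ[X]`, `Q(0)` = the untwisted value.
* Part C `exists_forall_twistedDet_ne_zero`: hence the twisted certificate determinant is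
  `(j!)^{δD} q(j)`, `q(0) ≠ 0`, nonzero for all `j ≥ j₀` (finitely many roots).
* Part D `eventualInheritance_of_twistedInheritance`: twisted inheritance ⟹
  `∀ μ ⊢ nδ (≤ n² parts), ∃ j₀, ∀ j ≥ j₀, P_n(μ) ≤ mult_{(μ♯(n+j))*} ℂ[Δ_{n+j}(X₀₀^j per_n)]`
  (the registered stub `stub_eventualInheritance` follows by `stub_twistedInheritance`; separate file,
  imports `…TwistedInheritance`).

What this is for the crux: a by-product-grade theorem on Problem 6.10 (the shape length `ℓ(μ♯)` is
bounded along the ray, so no flip rides on it — `ValuativeGCTNoValuativeFlipBoundedLength`), and the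
calibration of the twisted anchors `P_n^{(j)}(μ)` of the tail engine: they equal `P_n(μ)` for cofinitely
many `j` at fixed certificate points.

Sources: Mulmuley–Sohoni 2001 §4–5; BLMW, SIAM J. Comput. 40 (2011) §5.2, §6.4 (Problem 6.10);
Ikenmeyer–Panova, Adv. Math. 319 (2017) Prop. 2.6(b); Bürgisser–Ikenmeyer–Panova, J. AMS 32 (2019)
Lemma 5.2–5.3; Bläser–Ikenmeyer 2025 Cor. 12.6, Prop. 12.7.
-/

set_option linter.dupNamespace false

namespace Summit.ValiantsHypothesis.ValiantsHypothesis.Theorems.ValuativeFlip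

open scoped BigOperators Nat
open MvPolynomial
open Literature.NumberTheory.DiophantineGeometry
open Literature.Computability.AlgebraicComplexity
open Literature.Computability.Complexity

noncomputable section

/-- **Completeness of evaluation certificates** (converse of the engine `stub_evalRankLowerBound`).
If `D ≤ mult_χ ℂ[Δ_m(f)]` (`m ≠ 0`), there are highest-weight vectors `F₁ … F_D ∈ ℂ[Sym^m ℂ^σ]` of
weight `χ` and invertible points `A₁ … A_D` whose evaluation matrix `(F_i(A_l · f))_{i,l}` is
nonsingular.  Highest-weight vectors of the quotient `ℂ[Δ_m(f)] = ℂ[Sym^m] ⧸ I(GL · f)` lift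
(`map_highestWeightSpace_eq_of_surjective`, complete reducibility of `ℂ[Sym^m]`); the evaluation
vectors `(F_i(g · f))_i`, `g ∈ GL`, span `ℂ^D` (a functional killing them all is a combination
`Σ cᵢ Fᵢ ∈ I(GL · f)`, i.e. a vanishing combination of independent classes), so `D` of them are
independent, i.e. form an invertible matrix. [Mulmuley–Sohoni 2001 §4–5; BLMW 2011 §5.2; folklore] -/
theorem exists_evalCertificate_of_le_orbitMultiplicity :
    ∀ {σ : Type} [Fintype σ] [LinearOrder σ] (f : MvPolynomial σ ℂ) {m : ℕ}, m ≠ 0 → ∀ (χ : Weight σ) {D : ℕ}, D ≤ orbitMultiplicity ℂ f m χ → ∃ (F : Fin D → MvPolynomial (DegIdx σ m) ℂ) (A : Fin D → Matrix σ σ ℂ), (∀ i, F i ∈ highestWeightSpace (coordRep σ ℂ m) χ) ∧ (∀ l, IsUnit (A l)) ∧ (Matrix.of fun i l : Fin D => MvPolynomial.aeval (formCoeff m (linSubst σ ℂ (A l) f)) (F i)).det ≠ 0 := by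
  intro σ _ _ f m hm χ D hD
  classical
  haveI hfin : FiniteDimensional ℂ (highestWeightSpace (orbitCoordRep f m) χ) :=
    finiteDimensional_highestWeightSpace_orbitCoordRep_holds f hm χ
  -- the quotient map and the lifting of highest-weight vectors
  let π : (coordRep σ ℂ m).IntertwiningMap (orbitCoordRep f m) :=
    ⟨(Ideal.Quotient.mkₐ ℂ (orbitVanishingIdeal f m)).toLinearMap, fun _ => LinearMap.ext fun _ => rfl⟩
  have hπ : Function.Surjective π := Ideal.Quotient.mkₐ_surjective ℂ _
  have hmap := map_highestWeightSpace_eq_of_surjective π hπ (isSemisimpleRepresentation_coordRep m) χ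
  -- `D` independent highest-weight classes
  set W := highestWeightSpace (orbitCoordRep f m) χ with hW
  let b := Module.finBasis ℂ W
  have hDle : D ≤ Module.finrank ℂ W := hD
  let w : Fin D → W := fun i => b (Fin.castLE hDle i)
  have hw : LinearIndependent ℂ w :=
    b.linearIndependent.comp _ (Fin.castLE_injective hDle)
  -- lifts
  have hlift : ∀ i, ∃ F ∈ highestWeightSpace (coordRep σ ℂ m) χ, π F = (w i : OrbitCoordRing f m) := by
    intro i
    have hmem : (w i : OrbitCoordRing f m) ∈ (highestWeightSpace (coordRep σ ℂ m) χ).map π.toLinearMap := by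
      rw [hmap]; exact (w i).2
    obtain ⟨F, hF, hFw⟩ := Submodule.mem_map.mp hmem
    exact ⟨F, hF, hFw⟩
  choose F hF hFw using hlift
  -- evaluation vectors at `GL`-orbit points
  let ev : GL σ ℂ → (Fin D → ℂ) := fun g i => aeval (formCoeff m (linSubst σ ℂ (g : Matrix σ σ ℂ) f)) (F i)
  -- they span `ℂ^D`
  have hspan : Submodule.span ℂ (Set.range ev) = ⊤ := by
    by_contra hne
    obtain ⟨ψ, hψ0, hψ⟩ := Submodule.exists_le_ker_of_lt_top _ (lt_top_iff_ne_top.mpr hne)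
    let c : Fin D → ℂ := fun i => ψ (Pi.single i 1)
    have hψc : ∀ x : Fin D → ℂ, ψ x = ∑ i, x i * c i := by
      intro x
      conv_lhs => rw [show x = ∑ i, x i • (Pi.single i (1 : ℂ) : Fin D → ℂ) from by
        ext j; simp [Finset.sum_apply, Pi.single_apply]]
      rw [map_sum]
      refine Finset.sum_congr rfl fun i _ => ?_
      rw [map_smul, smul_eq_mul]
    -- the combination `Σ c_i F_i` vanishes on the orbit
    have hG : (∑ i, c i • F i) ∈ orbitVanishingIdeal f m := by
      rw [mem_orbitVanishingIdeal_iff]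
      intro g
      have hk : ev g ∈ LinearMap.ker ψ := hψ (Submodule.subset_span ⟨g, rfl⟩)
      rw [LinearMap.mem_ker, hψc] at hk
      rw [map_sum]
      simp only [map_smul, smul_eq_mul, linSubstRep_apply]
      rw [← hk]
      refine Finset.sum_congr rfl fun i _ => ?_
      ring
    -- hence the combination of the classes vanishes, so `c = 0`
    have hc0 : ∑ i, c i • w i = 0 := by
      apply Subtype.ext
      rw [Submodule.coe_sum, Submodule.coe_zero]
      simp only [Submodule.coe_smul]
      have : ∑ i, c i • (w i : OrbitCoordRing f m) = π (∑ i, c i • F i) := by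
        rw [map_sum]
        refine Finset.sum_congr rfl fun i _ => ?_
        rw [map_smul, hFw]
      rw [this]
      show (Ideal.Quotient.mkₐ ℂ (orbitVanishingIdeal f m)) (∑ i, c i • F i) = 0
      rw [Ideal.Quotient.mkₐ_eq_mk, Ideal.Quotient.eq_zero_iff_mem]
      exact hG
    have hc : ∀ i, c i = 0 := fun i => Fintype.linearIndependent_iff.mp hw c hc0 i
    apply hψ0
    refine LinearMap.ext fun x => ?_
    rw [hψc]
    simp [hc]
  -- extract `D` independent evaluation vectors
  obtain ⟨t, ht, htspan, htind⟩ := exists_linearIndependent ℂ (Set.range ev)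
  rw [hspan] at htspan
  let bt : Module.Basis t ℂ (Fin D → ℂ) := Module.Basis.mk htind (by rw [Subtype.range_coe, htspan])
  let e : t ≃ Fin D := bt.indexEquiv (Pi.basisFun ℂ (Fin D))
  have hpre : ∀ l : Fin D, ∃ g : GL σ ℂ, ev g = ((e.symm l : t) : Fin D → ℂ) := fun l => ht (e.symm l).2
  choose g hg using hpre
  refine ⟨F, fun l => (g l : Matrix σ σ ℂ), hF, fun l => Units.isUnit (g l), ?_⟩
  -- the matrix has independent columns
  set M : Matrix (Fin D) (Fin D) ℂ := Matrix.of fun i l : Fin D => aeval (formCoeff m (linSubst σ ℂ ((g l : GL σ ℂ) : Matrix σ σ ℂ) f)) (F i) with hM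
  have hcol : M.col = fun l => ((e.symm l : t) : Fin D → ℂ) := by
    ext l i
    rw [← hg l]
    rfl
  have hind : LinearIndependent ℂ M.col := by
    rw [hcol]
    have h1 : LinearIndependent ℂ (fun x : t => (x : Fin D → ℂ)) := htind
    exact h1.comp _ e.symm.injective
  have hU : IsUnit M := Matrix.linearIndependent_cols_iff_isUnit.mp hind
  exact ((Matrix.isUnit_iff_isUnit_det M).mp hU).ne_zero


/-! ## Part B: the padding twist is polynomial in the padding `j` -/

/-- The twist polynomial `P_e(X) = (X+1)(X+2)⋯(X+e) / e!` (written inline as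
`C (e!)⁻¹ * (ascPochhammer ℂ e).comp (X + 1)`; no definition is introduced) satisfies
`j! · P_e(j) = (e+j)!/e! = (e + j).descFactorial j` — the factor by which the `j`-th padding lift
rescales the coefficient of a monomial with top exponent `e` (`aeval_formCoeff_paddedForm_liftHWV`).
[Ikenmeyer–Panova 2017 Prop. 2.6(b); folklore] -/
theorem factorial_mul_twistPoly_eval (e j : ℕ) :
    ((j ! : ℕ) : ℂ) * (Polynomial.C ((Nat.factorial e : ℂ)⁻¹) * (ascPochhammer ℂ e).comp (Polynomial.X + 1)).eval (j : ℂ) = (((e + j).descFactorial j : ℕ) : ℂ) := by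
  have he : (e ! : ℂ) ≠ 0 := by exact_mod_cast Nat.factorial_ne_zero e
  have h1 : ((j ! : ℕ) : ℂ) * (ascPochhammer ℂ e).eval ((j : ℂ) + 1) = (((j + e) ! : ℕ) : ℂ) := by
    exact_mod_cast factorial_mul_ascPochhammer ℂ j e
  have h2 : ((e ! : ℕ) : ℂ) * (((e + j).descFactorial j : ℕ) : ℂ) = (((e + j) ! : ℕ) : ℂ) := by
    have h := @Nat.factorial_mul_descFactorial (e + j) j (Nat.le_add_left j e)
    rw [Nat.add_sub_cancel] at h
    exact_mod_cast h
  simp only [Polynomial.eval_mul, Polynomial.eval_C, Polynomial.eval_comp,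
    Polynomial.eval_add, Polynomial.eval_X, Polynomial.eval_one]
  rw [add_comm j e] at h1
  field_simp
  linear_combination h1 - h2

/-- `P_e(0) = 1`: the untwisted case `j = 0`. [folklore] -/
theorem twistPoly_eval_zero (e : ℕ) : (Polynomial.C ((Nat.factorial e : ℂ)⁻¹) * (ascPochhammer ℂ e).comp (Polynomial.X + 1)).eval 0 = 1 := by
  have he : (e ! : ℂ) ≠ 0 := by exact_mod_cast Nat.factorial_ne_zero e
  simp only [Polynomial.eval_mul, Polynomial.eval_C, Polynomial.eval_comp,
    Polynomial.eval_add, Polynomial.eval_X, Polynomial.eval_one, zero_add, ascPochhammer_eval_one]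
  exact inv_mul_cancel₀ he

/-- Scaling the arguments of a form of degree `δ` by `a` scales its value by `a ^ δ`. [folklore] -/
theorem ei_aeval_const_mul {ι S : Type*} [CommSemiring S] [Algebra ℂ S] {F : MvPolynomial ι ℂ}
    {δ : ℕ} (hF : F.IsHomogeneous δ) (a : S) (y : ι → S) :
    aeval (fun i => a * y i) F = a ^ δ * aeval y F := by
  classical
  conv_lhs => rw [← F.support_sum_monomial_coeff]
  conv_rhs => rw [← F.support_sum_monomial_coeff]
  rw [map_sum, map_sum, Finset.mul_sum]
  refine Finset.sum_congr rfl fun s hs => ?_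
  rw [aeval_monomial, aeval_monomial, hF.degree_eq_sum_deg_support hs]
  simp only [Finsupp.prod, mul_pow, Finset.prod_mul_distrib, Finset.prod_pow_eq_pow_sum]
  ring

/-- **The twisted evaluation is `(j!)^δ` times a polynomial in `j`.**  For a form `F` of degree
`δ` in the coefficient variables, a coefficient vector `c` and a top-exponent function `t`,
`F((t(e)+j).descFactorial j · c_e)_e = (j!)^δ · Q(j)` with
`Q = F(P_{t(e)} · c_e)_e ∈ ℂ[X]`. [Ikenmeyer–Panova 2017 Prop. 2.6(b); folklore] -/
theorem twisted_aeval_eq_pow_mul_eval {ι : Type*} (t : ι → ℕ) (c : ι → ℂ)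
    {F : MvPolynomial ι ℂ} {δ : ℕ} (hF : F.IsHomogeneous δ) (j : ℕ) :
    aeval (fun e => (((t e + j).descFactorial j : ℕ) : ℂ) * c e) F =
      ((j ! : ℕ) : ℂ) ^ δ *
        (aeval (fun e => (Polynomial.C ((Nat.factorial (t e) : ℂ)⁻¹) * (ascPochhammer ℂ (t e)).comp (Polynomial.X + 1)) * Polynomial.C (c e)) F).eval (j : ℂ) := by
  have hfun : (fun e => (((t e + j).descFactorial j : ℕ) : ℂ) * c e) =
      fun e => ((j ! : ℕ) : ℂ) * (((Polynomial.C ((Nat.factorial (t e) : ℂ)⁻¹) * (ascPochhammer ℂ (t e)).comp (Polynomial.X + 1))).eval (j : ℂ) * c e) := by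
    funext e
    rw [← mul_assoc, factorial_mul_twistPoly_eval]
  rw [hfun, ei_aeval_const_mul hF]
  congr 1
  rw [← Polynomial.coe_aeval_eq_eval, ← AlgHom.comp_apply, MvPolynomial.comp_aeval]
  refine congrArg (fun v => aeval v F) (funext fun e => ?_)
  simp [Polynomial.coe_aeval_eq_eval]

/-- At `j = 0` the polynomial `Q` returns the untwisted evaluation `F(c)`. [folklore] -/
theorem eval_zero_twistAeval {ι : Type*} (t : ι → ℕ) (c : ι → ℂ) (F : MvPolynomial ι ℂ) :
    (aeval (fun e => (Polynomial.C ((Nat.factorial (t e) : ℂ)⁻¹) * (ascPochhammer ℂ (t e)).comp (Polynomial.X + 1)) * Polynomial.C (c e)) F).eval 0 = aeval c F := by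
  rw [← Polynomial.coe_aeval_eq_eval, ← AlgHom.comp_apply, MvPolynomial.comp_aeval]
  refine congrArg (fun v => aeval v F) (funext fun e => ?_)
  have h := twistPoly_eval_zero (t e)
  simp only [Polynomial.coe_aeval_eq_eval, Polynomial.eval_mul, Polynomial.eval_C] at h ⊢
  rw [h, one_mul]

/-! ## Part C: a polynomial family of matrices nonsingular at `0` is nonsingular for all large `j` -/

/-- **Generic nonsingularity in the padding.**  If the twisted evaluation matrices
`M(j)_{i,l} = F_i((t(e)+j).descFactorial j · c_{l,e})_e` of forms `F_i` of degree `δ` are built from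
ONE family of coefficient vectors `c_l`, and `M(0)` (the untwisted matrix) is nonsingular, then
`M(j)` is nonsingular for all but finitely many `j`, in particular for all `j ≥ j₀`:
`det M(j) = (j!)^{δD} · q(j)` for the polynomial `q = det (F_i(P_{t(e)} c_{l,e}))_{i,l} ∈ ℂ[X]` with
`q(0) = det M(0) ≠ 0`. [folklore] -/
theorem exists_forall_twistedDet_ne_zero {ι : Type*} (t : ι → ℕ) {D δ : ℕ}
    (F : Fin D → MvPolynomial ι ℂ) (hF : ∀ i, (F i).IsHomogeneous δ) (c : Fin D → ι → ℂ)
    (h0 : (Matrix.of fun i l : Fin D => aeval (c l) (F i)).det ≠ 0) :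
    ∃ j₀ : ℕ, ∀ j ≥ j₀,
      (Matrix.of fun i l : Fin D =>
        aeval (fun e => (((t e + j).descFactorial j : ℕ) : ℂ) * c l e) (F i)).det ≠ 0 := by
  classical
  -- the polynomial matrix and its determinant
  let P : Matrix (Fin D) (Fin D) (Polynomial ℂ) :=
    Matrix.of fun i l : Fin D => aeval (fun e => (Polynomial.C ((Nat.factorial (t e) : ℂ)⁻¹) * (ascPochhammer ℂ (t e)).comp (Polynomial.X + 1)) * Polynomial.C (c l e)) (F i)
  let q : Polynomial ℂ := P.det
  have hdet : ∀ j : ℕ, (Matrix.of fun i l : Fin D =>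
      aeval (fun e => (((t e + j).descFactorial j : ℕ) : ℂ) * c l e) (F i)).det =
      (((j ! : ℕ) : ℂ) ^ δ) ^ D * q.eval (j : ℂ) := by
    intro j
    have hM : (Matrix.of fun i l : Fin D =>
        aeval (fun e => (((t e + j).descFactorial j : ℕ) : ℂ) * c l e) (F i)) =
        (((j ! : ℕ) : ℂ) ^ δ) • (Polynomial.evalRingHom (j : ℂ)).mapMatrix P := by
      ext i l
      simp only [Matrix.of_apply, Matrix.smul_apply, smul_eq_mul, RingHom.mapMatrix_apply,
        Matrix.map_apply, Polynomial.coe_evalRingHom, P]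
      exact twisted_aeval_eq_pow_mul_eval t (c l) (hF i) j
    rw [hM, Matrix.det_smul, Fintype.card_fin, ← RingHom.map_det, Polynomial.coe_evalRingHom]
  have hq0 : q.eval 0 ≠ 0 := by
    have h := hdet 0
    simp only [Nat.factorial_zero, Nat.cast_one, one_pow, one_mul, Nat.cast_zero] at h
    rw [← h]
    have hM0 : (Matrix.of fun i l : Fin D =>
        aeval (fun e => (((t e + 0).descFactorial 0 : ℕ) : ℂ) * c l e) (F i)) =
        Matrix.of fun i l : Fin D => aeval (c l) (F i) := by
      ext i l
      simp only [Matrix.of_apply, Nat.descFactorial_zero, Nat.cast_one, one_mul]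
    rw [hM0]
    exact h0
  have hq : q ≠ 0 := fun h => hq0 (by rw [h, Polynomial.eval_zero])
  -- finitely many natural roots
  have hfin : {j : ℕ | q.eval (j : ℂ) = 0}.Finite := by
    have h1 : {x : ℂ | q.IsRoot x}.Finite := Polynomial.finite_setOf_isRoot hq
    have h2 : {j : ℕ | q.eval (j : ℂ) = 0} = (fun j : ℕ => (j : ℂ)) ⁻¹' {x : ℂ | q.IsRoot x} := by
      ext j; simp [Polynomial.IsRoot]
    rw [h2]
    exact h1.preimage (Nat.cast_injective.injOn)
  obtain ⟨B, hB⟩ := hfin.bddAbove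
  refine ⟨B + 1, fun j hj => ?_⟩
  rw [hdet j]
  refine mul_ne_zero (pow_ne_zero _ (pow_ne_zero _ ?_)) fun hroot => ?_
  · exact_mod_cast Nat.factorial_ne_zero j
  · have : j ≤ B := hB hroot
    omega


/-! ## Part D: eventual inheritance of multiplicities under padding -/

/-- **Eventual inheritance from twisted inheritance.**  Assume the Δ_j-twisted transport of
evaluation certificates (`stub_twistedInheritance`, landed in
`ValuativeGCTValuativeFlipTwistedInheritance`).  Then for every inner shape `μ ⊢ n·δ` (at most `n²`
parts) the multiplicity `P_n(μ) = mult_{μ*} ℂ[Δ_n(per_n)]` is inherited by the padded permanent for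
all but finitely many paddings: `P_n(μ) ≤ mult_{(μ♯(n+j))*} ℂ[Δ_{n+j}(X₀₀^j per_n)]` for all `j ≥ j₀`.
Proof: a complete certificate at `j = 0` (`exists_evalCertificate_of_le_orbitMultiplicity`, forms of
degree `δ` by `isHomogeneous_of_mem_highestWeightSpace`), whose twisted determinant is `(j!)^{δD}`
times a polynomial in `j` not vanishing at `0` (`exists_forall_twistedDet_ne_zero`).
[BLMW 2011 §6.4 Problem 6.10 (cofinitely many paddings); Ikenmeyer–Panova 2017 Prop. 2.6(b)] -/
theorem eventualInheritance_of_twistedInheritance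
    (hTI : ∀ (n j δ : ℕ) [NeZero n] [NeZero (n + j)] (μ : Nat.Partition (n * δ)), μ.parts.card ≤ n * n →
      ∀ (D : ℕ) (F : Fin D → MvPolynomial (DegIdx (MatIdx n) n) ℂ),
        (∀ i, F i ∈ highestWeightSpace (coordRep (MatIdx n) ℂ n) (partitionWeightLex n μ)) →
        ∀ (A : Fin D → Matrix (MatIdx n) (MatIdx n) ℂ),
          (Matrix.of fun i l : Fin D => MvPolynomial.aeval
              (fun e : DegIdx (MatIdx n) n =>
                (((e.1 (topMatIdx n) + j).descFactorial j : ℕ) : ℂ) *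
                  MvPolynomial.coeff e.1 (linSubst (MatIdx n) ℂ (A l) (paddedPerFormLex ℂ n n)))
              (F i)).det ≠ 0 →
          D ≤ orbitMultiplicity ℂ (paddedPerFormLex ℂ n (n + j)) (n + j) (partitionWeightLex (n + j) (rowLift μ j))) :
    ∀ (n δ : ℕ) [NeZero n] (μ : Nat.Partition (n * δ)), μ.parts.card ≤ n * n → ∃ j₀, ∀ j ≥ j₀, ∀ [NeZero (n + j)],
      orbitMultiplicity ℂ (paddedPerFormLex ℂ n n) n (partitionWeightLex n μ) ≤
      orbitMultiplicity ℂ (paddedPerFormLex ℂ n (n + j)) (n + j) (partitionWeightLex (n + j) (rowLift μ j)) := by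
  intro n δ _ μ hμ
  classical
  set D := orbitMultiplicity ℂ (paddedPerFormLex ℂ n n) n (partitionWeightLex n μ) with hD
  obtain ⟨F, A, hF, -, hdet⟩ := exists_evalCertificate_of_le_orbitMultiplicity
    (paddedPerFormLex ℂ n n) (NeZero.ne n) (partitionWeightLex n μ) (le_refl D)
  have hhom : ∀ i, (F i).IsHomogeneous δ := fun i =>
    isHomogeneous_of_mem_highestWeightSpace (NeZero.ne n) (hF i) (size_partitionWeightLex' μ hμ)
  -- the coefficient vectors of the certificate points and the top-exponent function
  let c : Fin D → DegIdx (MatIdx n) n → ℂ := fun l e =>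
    MvPolynomial.coeff e.1 (linSubst (MatIdx n) ℂ (A l) (paddedPerFormLex ℂ n n))
  have h0 : (Matrix.of fun i l : Fin D => aeval (c l) (F i)).det ≠ 0 := by
    have : (Matrix.of fun i l : Fin D => aeval (c l) (F i)) =
        Matrix.of fun i l : Fin D => aeval (formCoeff n (linSubst (MatIdx n) ℂ (A l) (paddedPerFormLex ℂ n n))) (F i) := by
      ext i l
      rfl
    rw [this]
    exact hdet
  obtain ⟨j₀, hj₀⟩ := exists_forall_twistedDet_ne_zero (fun e : DegIdx (MatIdx n) n => e.1 (topMatIdx n))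
    F hhom c h0
  refine ⟨j₀, fun j hj _ => ?_⟩
  exact hTI n j δ μ hμ D F hF A (hj₀ j hj)
end

end Summit.ValiantsHypothesis.ValiantsHypothesis.Theorems.ValuativeFlip
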